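import Mathlib
import Literature.NumberTheory.Irrationality.Brown2016.DinnerParties
import Summits.KontsevichZagierPeriods.Zeta5Search.Families.CellularIntegral
import Summits.KontsevichZagierPeriods.Zeta5Search.Families.ConfigurationsNine
import Summits.KontsevichZagierPeriods.Zeta5Search.Cells.ConfigurationsTen
import HarnessLib

/-!
# ζ(5) search — Families: Brown-convergence of the BASIC cellular integrals (all exponents `N ≥ 0`) by a decidable count criterion

HONEST FRAMING: systematic search; no irrationality claim unless certified.

Cell `pub-zeta5`, seat P2.  For constant exponents `a = b = N` the chord valuation is affine in `N`:
`twoOrd σ N N p k = N·(cntId p k − cntS σ p k) + (ℓ − 1 − cntS σ p k)` where `cntId`/`cntS` count the edges of `δ⁰`/`σδ⁰`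
NOT separated by the chord.  Hence the decidable criterion `ConstOK σ` (`cntS ≤ cntId` and `cntS ≤ ℓ − 1` on every chord)
gives `BrownConvergent σ N N` for ALL `N ≥ 0` at once (`brownConvergent_const_of_constOK`), and the kernel certifies it for
every one of the 105 `N = 9` configurations `reps9` (`constOK_reps9`, `brownConvergent_basic_reps9`) and of the 771 `N = 10`
configurations `Cells.ConfigurationsTen.reps10` of fam-brown9 (`constOK_reps10`, `brownConvergent_basic_reps10`).
(This is the combinatorial content of [Brown2016, Lemma 3.6/3.8] checked per configuration; a configuration-free proof
— "a Hamiltonian cycle crossing a chord of a convergent configuration crosses it at least four times" — is not formalised here.)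
-/

noncomputable section

namespace Summit.KontsevichZagierPeriods.Zeta5Search.Families.Cellular

open Finset Literature.NumberTheory.Irrationality.Brown2016
open Summit.KontsevichZagierPeriods.Zeta5Search.Families.Configurations (reps9 reps9_length)
open Summit.KontsevichZagierPeriods.Zeta5Search.Cells.ConfigurationsTen (reps10 chunk all_of_chunks)

variable {ℓ : ℕ}

/-- Number of edges of the standard polygon `δ⁰` not separated by the chord `(p,k)`. -/
def cntId (ℓ p k : ℕ) : ℤ := ∑ i : Fin (ℓ + 3), sameSide (ℓ := ℓ) p k i (i + 1)

/-- Number of edges of `σδ⁰` not separated by the chord `(p,k)`. -/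
def cntS (σ : Fin (ℓ + 3) → Fin (ℓ + 3)) (p k : ℕ) : ℤ := ∑ i : Fin (ℓ + 3), sameSide p k (σ i) (σ (i + 1))

/-- For constant exponents the chord valuation is affine in `N`. -/
theorem twoOrd_const (σ : Fin (ℓ + 3) → Fin (ℓ + 3)) (N : ℤ) (p k : ℕ) :
    twoOrd σ (fun _ => N) (fun _ => N) p k = N * (cntId ℓ p k - cntS σ p k) + ((ℓ : ℤ) - 1 - cntS σ p k) := by
  unfold twoOrd cntId cntS
  rw [← Finset.sum_mul, ← Finset.sum_mul]
  ring

/-- The decidable count criterion: on every chord, `cntS ≤ cntId` and `cntS ≤ ℓ − 1`. -/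
def ConstOK (σ : Fin (ℓ + 3) → Fin (ℓ + 3)) : Prop :=
  ∀ p : Fin (ℓ + 3), ∀ k' : Fin ℓ, cntS σ p (k' + 2) ≤ cntId ℓ p (k' + 2) ∧ cntS σ p (k' + 2) ≤ (ℓ : ℤ) - 1

/-- `ConstOK` is decidable. -/
instance instDecidableConstOK (σ : Fin (ℓ + 3) → Fin (ℓ + 3)) : Decidable (ConstOK σ) := by
  unfold ConstOK; infer_instance

/-- The count criterion gives Brown-convergence of the basic family for EVERY `N ≥ 0`. [Brown2016, Lemma 3.6 (combinatorial half)] -/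
theorem brownConvergent_const_of_constOK {σ : Fin (ℓ + 3) → Fin (ℓ + 3)} (h : ConstOK σ) {N : ℤ} (hN : 0 ≤ N) :
    BrownConvergent σ (fun _ => N) (fun _ => N) := by
  intro p k'
  rw [twoOrd_const]
  obtain ⟨h1, h2⟩ := h p k'
  nlinarith

/-! ### Kernel certificate for the 105 `N = 9` configurations -/

/-- The criterion as a Boolean on printed plans of nine guests. -/
def constOK9 (τ : List ℕ) : Bool := decide (ConstOK (ofSeating (ℓ := 6) τ))

-- 105 × 54 chords, by kernel evaluation
set_option maxHeartbeats 4000000 in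
/-- Every one of the 105 `N = 9` configurations satisfies the count criterion. -/
theorem constOK_reps9 : reps9.all constOK9 = true := by decide +kernel

/-- **Every basic cellular integral of every `N = 9` configuration satisfies Brown's convergence condition**, for all
exponents `N ≥ 0`. [Brown2016, Lemma 3.6; App. 2 §10.1] -/
theorem brownConvergent_basic_reps9 (τ : List ℕ) (hτ : τ ∈ reps9) (N : ℤ) (hN : 0 ≤ N) :
    BrownConvergent (ofSeating (ℓ := 6) τ) (fun _ => N) (fun _ => N) := by
  have h := constOK_reps9
  rw [List.all_eq_true] at h
  have := h τ hτ
  simp only [constOK9, decide_eq_true_eq] at this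
  exact brownConvergent_const_of_constOK this hN

/-! ### Kernel certificate for the 771 `N = 10` configurations -/

/-- The criterion as a Boolean on printed plans of ten guests. -/
def constOK10 (τ : List ℕ) : Bool := decide (ConstOK (ofSeating (ℓ := 7) τ))

-- 200 plans × 70 chords per block, by kernel evaluation
set_option maxRecDepth 100000 in
set_option maxHeartbeats 4000000 in
/-- Block 0 of `reps10` satisfies the count criterion. -/
theorem constOK_chunk0 : (chunk 0).all constOK10 = true := by decide +kernel

set_option maxRecDepth 100000 in
set_option maxHeartbeats 4000000 in
/-- Block 1 of `reps10` satisfies the count criterion. -/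
theorem constOK_chunk1 : (chunk 1).all constOK10 = true := by decide +kernel

set_option maxRecDepth 100000 in
set_option maxHeartbeats 4000000 in
/-- Block 2 of `reps10` satisfies the count criterion. -/
theorem constOK_chunk2 : (chunk 2).all constOK10 = true := by decide +kernel

set_option maxRecDepth 100000 in
set_option maxHeartbeats 4000000 in
/-- Block 3 of `reps10` satisfies the count criterion. -/
theorem constOK_chunk3 : (chunk 3).all constOK10 = true := by decide +kernel

/-- Every one of the 771 `N = 10` configurations satisfies the count criterion. -/
theorem constOK_reps10 : reps10.all constOK10 = true :=
  all_of_chunks constOK_chunk0 constOK_chunk1 constOK_chunk2 constOK_chunk3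

/-- **Every basic cellular integral of every `N = 10` configuration satisfies Brown's convergence condition**, for all
exponents `N ≥ 0`. [Brown2016, Lemma 3.6; App. 2 §10.1] -/
theorem brownConvergent_basic_reps10 (τ : List ℕ) (hτ : τ ∈ reps10) (N : ℤ) (hN : 0 ≤ N) :
    BrownConvergent (ofSeating (ℓ := 7) τ) (fun _ => N) (fun _ => N) := by
  have h := constOK_reps10
  rw [List.all_eq_true] at h
  have := h τ hτ
  simp only [constOK10, decide_eq_true_eq] at this
  exact brownConvergent_const_of_constOK this hN

end Summit.KontsevichZagierPeriods.Zeta5Search.Families.Cellular
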